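import Mathlib
import Summits.KontsevichZagierPeriods.Zeta5Search.BrickHoleMultiplier

/-!
# BrickHoleConst — zi-p2's THEOREM 10 LEMMA 10.2 (a), valuation: the constant `a` of the hole identity
`rescale_p F_K = C a·F̃_{K'}·holePoly·U` has `v_p(a) ≥ A` (in fact `= A + B|ε| + c + (A−2B)v_p(N')`; cell zeta5-irr)

HONEST FRAMING: systematic search; no irrationality claim unless certified. INSTRUMENT lemma of the ζ(5)
census cell zeta5-irr (HOME `run/shared/lean/pub/zeta5-irr/`; memo `zi-p2/probes/B8/thm10/THEOREM10.md` (sealed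
eeb9a92811d678e0) LEMMA 10.2 «Λ_K = (−1)^{(N−n)B+Bε₁}·p^{A+B|ε|+c}·θ_K·Ξ_K … a unit … so v(Λ_K) = A + B|ε| + c
EXACTLY»). Here `a = (m+1)^{A−2B}·Λ_K` (the tree's hat/hole normalisation), and only the inequality `v(a) ≤ exp(−A)`
needed by the two-scale mechanism (`BrickHatReduction.twoScale_depth`) is recorded, off the exact centre. Nothing here
is about ζ(5); no irrationality content; filing moves no rung. Filed by the engine seat zi-eng (g10).

## The statement (digits `i + i' = n₀ + p`, `i, i' < p`, `n₀ < p`; blocks `J + M = m`; `n = n₀ + (m+1)p`, `k = i + Jp`)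

* `holeConst_closed`: `a·Q^{cl}(0)·Û·(m+1)^{2B}·s₀ = s₁·(n/2−k)^ε·p^A·(m+1)^A·Ŷ` (exact, in `ℚ`).
* **`padicValuation_holeConst_le`**: for `a·holePoly(0)·c̃_{J,A}(m) = c_{k,A}(n)` and `2k ≠ n ∨ ε = 0`:
  `v(a) ≤ exp(−A)` (`p` odd, `2B ≤ A`, `ε ≤ 1`).
-/

namespace Summit.KontsevichZagierPeriods.Zeta5Search.BrickHoleConst

open Finset Nat Polynomial WithZero
open Summit.KontsevichZagierPeriods.Zeta5Search.BrickTopCoefficient (cTop)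
open Summit.KontsevichZagierPeriods.Zeta5Search.BrickLambda (cTop_zero_ne_zero padicValuation_two)
open Summit.KontsevichZagierPeriods.Zeta5Search.BrickLambdaCirc (padicValuation_centre_eq_one)
open Summit.KontsevichZagierPeriods.Zeta5Search.BrickDigitStripCirc (centreCarry centreCarry_le_one)
open Summit.KontsevichZagierPeriods.Zeta5Search.BrickLambdaClosedForm (padicValuation_unitFactorial)
open Summit.KontsevichZagierPeriods.Zeta5Search.BrickHatStrip (hatPoly hatPoly_eval_zero_ne_zero)
open Summit.KontsevichZagierPeriods.Zeta5Search.BrickHatMultiplier (hatPoly_mul_cTop_zero)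
open Summit.KontsevichZagierPeriods.Zeta5Search.BrickHatLambda (not_dvd_centre_hat)
open Summit.KontsevichZagierPeriods.Zeta5Search.BrickHoleStrip (classPoly holePoly)
open Summit.KontsevichZagierPeriods.Zeta5Search.BrickHoleMultiplier (holeUnitPart holeGainPart cTop_mul_holeUnitPart
  padicValuation_holeUnitPart)
open Literature.NumberTheory.LFunctions (padicValuation_natCast_le_one padicValuation_natCast_eq_one)

variable {p : ℕ} [Fact p.Prime]

section const

variable (hp2 : p ≠ 2) {A B ε n₀ i i' J M : ℕ} (hA : Even A) (hAB : 2 * B ≤ A) (hε : ε ≤ 1) (hii : i + i' = n₀ + p)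
  (hi : i < p) (hi' : i' < p) (hn₀ : n₀ < p)
include hii hi hi' hn₀

/-- **The hole constant in closed form**: for `a` with `a·holePoly(0)·c̃_{J,A}(m) = c_{k,A}(n)`:
`a·Q^{cl}(0)·Û·(m+1)^{2B}·s₀ = s₁·(n/2−k)^ε·(p^A·(m+1)^A)·Ŷ`, `s₀ = (−1)^{(m+1)B+JA}`, `s₁ = (−1)^{nB+kA}`. -/
theorem holeConst_closed {a : ℚ}
    (ha : a * (holePoly B ε p n₀ (J + M) i J).eval 0 * cTop A B 0 (J + M) J = cTop A B ε (n₀ + (J + M + 1) * p) (i + J * p)) :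
    a * (classPoly B ε p n₀ (J + M) i J).eval 0 * (holeUnitPart p A B n₀ i i' J M : ℚ) *
        (((J + M + 1 : ℕ) : ℚ)) ^ (2 * B) * (-1) ^ ((J + M + 1) * B + J * A) =
      (-1) ^ ((n₀ + (J + M + 1) * p) * B + (i + J * p) * A) *
        ((((n₀ + (J + M + 1) * p : ℕ) : ℚ)) / 2 - ((i + J * p : ℕ) : ℚ)) ^ ε *
        ((p : ℚ) ^ A * (((J + M + 1 : ℕ) : ℚ)) ^ A) * (holeGainPart p A B n₀ i i' J M : ℚ) := by
  have hhat := hatPoly_mul_cTop_zero (A := A) (B := B) (J := J) (M := M)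
  have key := cTop_mul_holeUnitPart (p := p) (A := A) (B := B) (ε := ε) (J := J) (M := M) hii hi hi' hn₀
  have hQ : (holePoly B ε p n₀ (J + M) i J).eval 0 = (hatPoly B (J + M) J).eval 0 * (classPoly B ε p n₀ (J + M) i J).eval 0 := by
    unfold holePoly; rw [eval_mul]
  rw [hQ] at ha
  have hT0 : (((J + M).choose J : ℕ) : ℚ) ^ A *
      ((((J + M + 1 + J).choose J : ℕ) : ℚ) * (((M + (J + M + 1)).choose (J + M + 1) : ℕ) : ℚ)) ^ B ≠ 0 := by
    have h1 : 0 < (J + M).choose J := Nat.choose_pos (Nat.le_add_right J M)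
    have h2 : 0 < (J + M + 1 + J).choose J := Nat.choose_pos (by omega)
    have h3 : 0 < (M + (J + M + 1)).choose (J + M + 1) := Nat.choose_pos (Nat.le_add_left _ _)
    positivity
  apply mul_right_cancel₀ hT0
  calc _ = a * (classPoly B ε p n₀ (J + M) i J).eval 0 * (holeUnitPart p A B n₀ i i' J M : ℚ) *
        ((-1) ^ ((J + M + 1) * B + J * A) * (((J + M + 1 : ℕ) : ℚ)) ^ (2 * B) *
          ((((J + M).choose J : ℕ) : ℚ) ^ A *
            ((((J + M + 1 + J).choose J : ℕ) : ℚ) * (((M + (J + M + 1)).choose (J + M + 1) : ℕ) : ℚ)) ^ B)) := by ring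
    _ = a * (classPoly B ε p n₀ (J + M) i J).eval 0 * (holeUnitPart p A B n₀ i i' J M : ℚ) *
        ((hatPoly B (J + M) J).eval 0 * cTop A B 0 (J + M) J) := by rw [hhat]
    _ = a * ((hatPoly B (J + M) J).eval 0 * (classPoly B ε p n₀ (J + M) i J).eval 0) * cTop A B 0 (J + M) J *
        (holeUnitPart p A B n₀ i i' J M : ℚ) := by ring
    _ = cTop A B ε (n₀ + (J + M + 1) * p) (i + J * p) * (holeUnitPart p A B n₀ i i' J M : ℚ) := by rw [ha]
    _ = _ := by rw [key]; ring

omit hii hi hi' hn₀ in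
/-- `v(Q^{cl}(0)) = v(J+m+2)^{Bε₁}·v(2m+2−J)^{Bε₂}·v(y_c)^{ε c_c}`. -/
theorem padicValuation_classPoly_eval_zero :
    Rat.padicValuation p ((classPoly B ε p n₀ (J + M) i J).eval 0) =
      Rat.padicValuation p (((J + M + 1 + J + 1 : ℕ) : ℚ)) ^ (B * ((n₀ + i) / p)) *
        Rat.padicValuation p (((J + M + 1 + M + 1 : ℕ) : ℚ)) ^ (B * ((n₀ + (n₀ + p - i)) / p)) *
        Rat.padicValuation p (((((n₀ + (J + M + 1) * p : ℕ) : ℚ)) / 2 - ((i + J * p : ℕ) : ℚ)) / p) ^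
          (ε * centreCarry p (n₀ + (J + M + 1) * p) (i + J * p)) := by
  unfold classPoly
  simp only [eval_mul, eval_pow, eval_add, eval_X, eval_C, zero_add, map_mul, map_pow]
  congr 2
  · congr 1
    rw [Valuation.map_neg, ← Nat.cast_add, show J + (J + M + 1 + 1) = J + M + 1 + J + 1 by ring]
  · congr 1
    rw [show ((J + M : ℕ) : ℚ) + ((J + M + 1 + 1 : ℕ) : ℚ) - J = ((J + M + 1 + M + 1 : ℕ) : ℚ) by push_cast; ring]

omit hii hi hi' hn₀ in
/-- `v(Ŷ) = (exp(−1)·v(J+m+2))^{ε₁B}·(exp(−1)·v(2m+2−J))^{ε₂B}` (the unit factorials are units). -/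
theorem padicValuation_holeGainPart :
    Rat.padicValuation p (holeGainPart p A B n₀ i i' J M : ℚ) =
      (exp (-1 : ℤ) * Rat.padicValuation p (((J + M + 1 + J + 1 : ℕ) : ℚ))) ^ ((n₀ + i) / p * B) *
        (exp (-1 : ℤ) * Rat.padicValuation p (((J + M + 1 + M + 1 : ℕ) : ℚ))) ^ ((n₀ + i') / p * B) := by
  unfold holeGainPart
  push_cast
  simp only [map_mul, map_pow, padicValuation_unitFactorial, one_pow, one_mul, mul_one, Rat.padicValuation_self]
  rw [← pow_mul, ← pow_mul]

omit [Fact p.Prime] hii hi hi' hn₀ in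
set_option linter.unusedSimpArgs false in
/-- The valuation bookkeeping of `padicValuation_holeConst_le`, on abstract values: from
`va·(v1^{e₁B} v2^{e₂B} vy^k)·vn^{2B} = vc^ε·(exp(−A) vn^A)·(exp(−1)^{e₁B}v1^{e₁B}·(exp(−1)^{e₂B}v2^{e₂B}))` with units
`v1, v2, vn ≠ 0`, `vn, vc ≤ 1`, `2B ≤ A`, and either `k = 0` or (`k = 1`, `vy = vc·exp(1)`, `vc ≠ 0`): `va ≤ exp(−A)`. -/
theorem val_aux {va vc vy vn v1 v2 : WithZero (Multiplicative ℤ)} {A' B' ε' e₁ e₂ k : ℕ} (hAB' : 2 * B' ≤ A')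
    (h : va * (v1 ^ (e₁ * B') * v2 ^ (e₂ * B') * vy ^ k) * vn ^ (2 * B') =
      vc ^ ε' * (exp (-(A' : ℤ)) * vn ^ A') * (exp (-1 : ℤ) ^ (e₁ * B') * v1 ^ (e₁ * B') *
        (exp (-1 : ℤ) ^ (e₂ * B') * v2 ^ (e₂ * B'))))
    (hv1 : v1 ≠ 0) (hv2 : v2 ≠ 0) (hvn0 : vn ≠ 0) (hvn1 : vn ≤ 1) (hvc1 : vc ≤ 1)
    (hk : k = 0 ∨ (k = 1 ∧ ε' = 1 ∧ vy = vc * exp (1 : ℤ) ∧ vc ≠ 0)) : va ≤ exp (-(A' : ℤ)) := by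
  have hX : v1 ^ (e₁ * B') * v2 ^ (e₂ * B') ≠ 0 := mul_ne_zero (pow_ne_zero _ hv1) (pow_ne_zero _ hv2)
  have h2 : va * vy ^ k * vn ^ (2 * B') * (v1 ^ (e₁ * B') * v2 ^ (e₂ * B')) =
      vc ^ ε' * (exp (-(A' : ℤ)) * vn ^ A') * (exp (-1 : ℤ) ^ (e₁ * B') * exp (-1 : ℤ) ^ (e₂ * B')) *
        (v1 ^ (e₁ * B') * v2 ^ (e₂ * B')) := by
    calc _ = va * (v1 ^ (e₁ * B') * v2 ^ (e₂ * B') * vy ^ k) * vn ^ (2 * B') := by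
          simp only [mul_assoc, mul_comm, mul_left_comm]
      _ = _ := h
      _ = _ := by simp only [mul_assoc, mul_comm, mul_left_comm]
  have h3 := mul_right_cancel₀ hX h2
  have hR : exp (-(A' : ℤ)) * vn ^ A' * (exp (-1 : ℤ) ^ (e₁ * B') * exp (-1 : ℤ) ^ (e₂ * B')) ≤
      exp (-(A' : ℤ)) * vn ^ (2 * B') := by
    rw [show vn ^ A' = vn ^ (A' - 2 * B') * vn ^ (2 * B') by rw [← pow_add, Nat.sub_add_cancel hAB']]
    have he1 : exp (-1 : ℤ) ≤ 1 := by rw [← exp_zero, exp_le_exp]; norm_num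
    calc _ ≤ (exp (-(A' : ℤ)) * (1 * vn ^ (2 * B'))) * (1 * 1) :=
          mul_le_mul' (mul_le_mul' le_rfl (mul_le_mul' (pow_le_one' hvn1 _) le_rfl))
            (mul_le_mul' (pow_le_one' he1 _) (pow_le_one' he1 _))
      _ = _ := by rw [one_mul, mul_one, mul_one]
  have cancel : ∀ {x : WithZero (Multiplicative ℤ)}, x * vn ^ (2 * B') ≤ exp (-(A' : ℤ)) * vn ^ (2 * B') →
      x ≤ exp (-(A' : ℤ)) := fun {x} key => by
    have h' := mul_le_mul' (le_refl (vn ^ (2 * B'))⁻¹) key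
    rwa [mul_comm x, mul_comm (exp _), ← mul_assoc, ← mul_assoc, inv_mul_cancel₀ (pow_ne_zero _ hvn0), one_mul,
      one_mul] at h'
  rcases hk with h0 | ⟨h1, hε1, hvy', hvc0⟩
  · rw [h0, pow_zero, mul_one] at h3
    refine cancel ?_
    rw [h3, mul_assoc (vc ^ ε')]
    calc _ ≤ 1 * (exp (-(A' : ℤ)) * vn ^ (2 * B')) := mul_le_mul' (pow_le_one' hvc1 ε') hR
      _ = _ := one_mul _
  · rw [h1, pow_one, hvy', hε1, pow_one] at h3
    have h4 : (va * exp (1 : ℤ) * vn ^ (2 * B')) * vc =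
        (exp (-(A' : ℤ)) * vn ^ A' * (exp (-1 : ℤ) ^ (e₁ * B') * exp (-1 : ℤ) ^ (e₂ * B'))) * vc := by
      calc _ = va * (vc * exp (1 : ℤ)) * vn ^ (2 * B') := by simp only [mul_assoc, mul_comm, mul_left_comm]
        _ = _ := h3
        _ = _ := by simp only [mul_assoc, mul_comm, mul_left_comm]
    have h5 := mul_right_cancel₀ hvc0 h4
    refine cancel ?_
    calc va * vn ^ (2 * B') ≤ va * exp (1 : ℤ) * vn ^ (2 * B') :=
          mul_le_mul' (le_mul_of_one_le_right' (by rw [← exp_zero, exp_le_exp]; norm_num)) le_rfl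
      _ = _ := h5
      _ ≤ _ := hR

include hp2 hAB hε in
/-- **`v(a) ≤ exp(−A)` for the hole constant** (off the exact centre): `a·holePoly(0)·c̃_{J,A}(m) = c_{k,A}(n)` and
`2k ≠ n ∨ ε = 0` imply `v_p(a) ≥ A` (zi-p2: `= A + B|ε| + c` up to the normalisation `(m+1)^{A−2B}`). -/
theorem padicValuation_holeConst_le {a : ℚ}
    (ha : a * (holePoly B ε p n₀ (J + M) i J).eval 0 * cTop A B 0 (J + M) J = cTop A B ε (n₀ + (J + M + 1) * p) (i + J * p))
    (hcen : 2 * (i + J * p) ≠ n₀ + (J + M + 1) * p ∨ ε = 0) :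
    Rat.padicValuation p a ≤ exp (-(A : ℤ)) := by
  have hp : p.Prime := Fact.out
  have hpQ : (p : ℚ) ≠ 0 := by exact_mod_cast hp.ne_zero
  have hnQ : (((J + M + 1 : ℕ) : ℚ)) ≠ 0 := by positivity
  have hi'eq : n₀ + (n₀ + p - i) = n₀ + i' := by omega
  have h := congrArg (Rat.padicValuation p) (holeConst_closed (p := p) (A := A) (B := B) (ε := ε) hii hi hi' hn₀ ha)
  simp only [map_mul, map_pow, Valuation.map_neg, map_one, one_pow, mul_one, one_mul, padicValuation_holeUnitPart,
    Rat.padicValuation_self, padicValuation_classPoly_eval_zero, padicValuation_holeGainPart, hi'eq] at h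
  rw [← exp_nsmul, nsmul_eq_mul, mul_neg_one] at h
  -- normalise the exponents of the class values and expand the powers of products
  rw [mul_comm B ((n₀ + i) / p), mul_comm B ((n₀ + i') / p), mul_pow, mul_pow] at h
  have hv1 : Rat.padicValuation p (((J + M + 1 + J + 1 : ℕ) : ℚ)) ≠ 0 := (Valuation.ne_zero_iff _).2 (by positivity)
  have hv2 : Rat.padicValuation p (((J + M + 1 + M + 1 : ℕ) : ℚ)) ≠ 0 := (Valuation.ne_zero_iff _).2 (by positivity)
  have hvn0 : Rat.padicValuation p (((J + M + 1 : ℕ) : ℚ)) ≠ 0 := (Valuation.ne_zero_iff _).2 hnQ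
  have hvn1 : Rat.padicValuation p (((J + M + 1 : ℕ) : ℚ)) ≤ 1 := padicValuation_natCast_le_one _
  have hvc1 : Rat.padicValuation p ((((n₀ + (J + M + 1) * p : ℕ) : ℚ)) / 2 - ((i + J * p : ℕ) : ℚ)) ≤ 1 := by
    rw [show (((n₀ + (J + M + 1) * p : ℕ) : ℚ)) / 2 - ((i + J * p : ℕ) : ℚ) =
        ((((n₀ + (J + M + 1) * p : ℕ) : ℤ) - 2 * (i + J * p : ℕ) : ℤ) : ℚ) / 2 by push_cast; ring,
      map_div₀, padicValuation_two hp2, div_one, Rat.padicValuation_cast]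
    exact Int.padicValuation_le_one _ _
  -- the centre class
  have hk : ε * centreCarry p (n₀ + (J + M + 1) * p) (i + J * p) = 0 ∨
      (ε * centreCarry p (n₀ + (J + M + 1) * p) (i + J * p) = 1 ∧ ε = 1 ∧
        Rat.padicValuation p (((((n₀ + (J + M + 1) * p : ℕ) : ℚ)) / 2 - ((i + J * p : ℕ) : ℚ)) / p) =
          Rat.padicValuation p ((((n₀ + (J + M + 1) * p : ℕ) : ℚ)) / 2 - ((i + J * p : ℕ) : ℚ)) * exp (1 : ℤ) ∧
        Rat.padicValuation p ((((n₀ + (J + M + 1) * p : ℕ) : ℚ)) / 2 - ((i + J * p : ℕ) : ℚ)) ≠ 0) := by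
    have hc1 := centreCarry_le_one p (n₀ + (J + M + 1) * p) (i + J * p)
    rcases Nat.le_one_iff_eq_zero_or_eq_one.1 hε with h0 | h1
    · left; rw [h0, zero_mul]
    · rcases Nat.le_one_iff_eq_zero_or_eq_one.1 hc1 with c0 | c1
      · left; rw [c0, mul_zero]
      · right
        subst h1
        have hc2 : 2 * (i + J * p) ≠ n₀ + (J + M + 1) * p := by
          rcases hcen with h | h
          · exact h
          · exact absurd h one_ne_zero
        have hc0 : (((n₀ + (J + M + 1) * p : ℕ) : ℚ)) / 2 - ((i + J * p : ℕ) : ℚ) ≠ 0 := by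
          intro h
          have : (((n₀ + (J + M + 1) * p : ℕ) : ℚ)) = 2 * ((i + J * p : ℕ) : ℚ) := by linarith
          exact hc2 (by exact_mod_cast this.symm)
        refine ⟨by rw [c1], rfl, ?_, (Valuation.ne_zero_iff _).2 hc0⟩
        rw [map_div₀, Rat.padicValuation_self, div_eq_mul_inv, ← exp_neg, neg_neg]
  exact val_aux hAB h hv1 hv2 hvn0 hvn1 hvc1 hk

end const

end Summit.KontsevichZagierPeriods.Zeta5Search.BrickHoleConst
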